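import Summits.HodgeConjecture.HodgeConjecture.Theses.SecondaryPeriods
import Summits.HodgeConjecture.HodgeConjecture.Theorems.SecondaryPeriodsConiveauOneFailureStubSurfaceGysin
import Summits.HodgeConjecture.HodgeConjecture.Theorems.SecondaryPeriodsConiveauOneFailureStubCurveOnSurface
import Summits.HodgeConjecture.HodgeConjecture.Theorems.SecondaryPeriodsConiveauOneFailureStubHodgeSplitting
import Summits.HodgeConjecture.HodgeConjecture.Theorems.SecondaryPeriodsConiveauOneFailureStubAlgebraicSplitting
import Summits.HodgeConjecture.HodgeConjecture.Theorems.SecondaryPeriodsConiveauOneFailureStubGysinCompCorrAction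
import Summits.HodgeConjecture.HodgeConjecture.Theorems.SecondaryPeriodsConiveauOneFailureTransfer
import Summits.HodgeConjecture.HodgeConjecture.Theorems.SecondaryPeriodsConiveauOneFailureInstrumentForm
import Summits.HodgeConjecture.HodgeConjecture.Theorems.SecondaryPeriodsConiveauOneFailureHabitat
import Summits.HodgeConjecture.HodgeConjecture.Theorems.SecondaryPeriodsConiveauOneFailureTightness
import Summits.HodgeConjecture.HodgeConjecture.Theorems.SecondaryPeriodsConiveauOneFailureAbelianNoGo

/-!
# Skeleton of the crux `ConiveauOneFailure` (stmt-HodgeConjecture-3540), route `SecondaryPeriods` —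
# line `birth` ("no curve correspondence carries the attractor plane"), RESHAPED by lead c1 (gen 2),
# continued by lead c2 (gen 2c: instrument form, habitat inhabitation, tightness — stub set unchanged)
# and by lead c3 (gen 2d: the ABELIAN SECTOR of the habitat is not a witness, granted Markman 2025 — stub set unchanged)

`ConiveauOneFailure := ¬ LevelOneConiveauThreefolds` is the NEGATIVE bet of the two-sided test
route: Grothendieck's amended generalised Hodge conjecture GHC(3,1) fails for some smooth projective
threefold `Y/ℂ` — some rational sub-Hodge structure `V ⊆ H³(Y(ℂ))` of level one is not supported on
a divisor (`V ⊄ N¹H³(Y) = supportedClasses Y 3 1`). A proof of a negated universal statement is a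
WITNESS plus an OBSTRUCTION; the line cuts it along the classical TRANSFER of the coniveau condition
to the cycle side of the fourfolds `Y × C`, where the route's instrument (secondary periods =
Abel–Jacobi invariants of codimension-two cycles on `Y × C`) lives.

## The reshape (gen 1 → gen 2), same composition idea

The registered birth skeleton (gen 1, planner) had three stubs: STUB 1 (Deligne transfer of `N¹H³`
to finitely many algebraic correspondences from `H¹` of smooth projective varieties), STUB 2 (curve
domination: finitely many such correspondences are dominated by ONE correspondence from ONE curve —
size L: curve sections of PRODUCTS, Künneth in degree one, and the composition of two arbitrary
algebraic correspondences, which in the tree is CONDITIONAL on the multiplicativity of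
`algebraicClasses`, `fulton1998_map_mem_algebraicClasses`, undischarged), STUB 3 (the heart). The
lead keeps the composition `crux-instance ⟹ V ⊆ N¹H³ ⟹ carried on the cycle side ⟹ ⊥` and the
heart, and re-cuts the two transfers along what the tree proves UNCONDITIONALLY:

* STUB `stub_supportedClasses_le_surfaceGysin` (S1, M): `N¹H³(Y)` lies in a finite sum of GYSIN
  images `g_{j*} H¹(S_j(ℂ))` of smooth projective SURFACES `g_j : S_j → Y` (finite-dimensionality
  of `H³`; one divisor `Z₀`; `exists_equidim_family_iUnion_range_eq` = Hironaka on the components;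
  Deligne Hodge III Cor. 8.2.8 = the DISCHARGED `Deligne1974_ker_restrictCompl_eq_iSup_range_complexGysin_holds`;
  in degree `3` only `a = 1` survives).
* STUB `stub_curveOnSurface_injective` (S2a, S): every smooth projective surface `S` receives a
  morphism `i : C → S` from a smooth projective curve with `i^* : H¹(S(ℂ)) → H¹(C(ℂ))` injective
  (a smooth member of a Lefschetz pencil through the blow-down: the PROVED
  `exists_fiberNet_pencil_weakLefschetz_holds` with `r = 1`, `smoothBase_nonempty_of_charZero`).
* STUB `stub_surjective_hodgeMap_of_injective` (S2b₁, L): if `i^*` is injective on `H¹`, some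
  SURJECTIVE `φ : H¹(C(ℂ)) ↠ H¹(S(ℂ))` is rational and of type `(0,0)` w.r.t. Hodge models `B`, `A`
  (polarisable weight-one Hodge structures are semisimple, `SubHodgeStructure.exists_isCompl` +
  `smoothProjective_hodgeStructure_isPolarizable_holds`: a retraction `ρ` of `i^*`, read over `ℂ`).
* STUB `stub_surjective_algebraic_corrAction_of_hodgeMap` (S2b₂, S): such a `φ` is `t⁻¹ • [γ]_*`
  for an ALGEBRAIC class `γ ∈ N¹H²((S ⊗ C)(ℂ))` (Voisin I Lemma 11.41
  `exists_rational_hodgeClass_corrAction_eq_smul` with `r = 0`, `e = 1`; Lefschetz `(1,1)`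
  `lefschetzOneOne_rational_holds` on the threefold `S ⊗ C`), so `[γ]_*` is onto.
* STUB `stub_isAlgebraicCorrespondence_gysin_comp_corrAction` (S2c, S–M): post-composing the
  action of an algebraic class `γ` on `S ⊗ C` with the Gysin map of `g : S → Y` is the action of the
  algebraic class `(g ⊗ 𝟙_C)_* γ ∈ N²H⁴((Y ⊗ C)(ℂ))` (projection formula `complexGysin_cup`,
  functoriality `complexGysin_comp`, `whiskerRight_fst/snd`, `complexGysin_mem_algebraicClasses`,
  `isAlgebraicCorrespondence_corrAction`) — the only composition of correspondences the line needs,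
  unconditional.
* STUB `stub_attractorPlane_offCurveCorrespondences` (S3, THE HEART, open): an attractor plane of a
  Calabi–Yau-type threefold carried by NO finite family of algebraic curve correspondences
  `H¹(C_j(ℂ)) → H³(Y(ℂ))` (the crux's binders verbatim; `CarriedByCurveCorrespondences` is the
  finite-family form — one curve per surface component, which avoids products of curves; it is
  implied by, and modulo S1–S2 implies, the habitat instance of the crux, see
  `heart_of_unsupported_attractorPlane` / `ConiveauOneFailure_of`).

So modulo S1–S2 (all known, all with discharged carriers) GHC(3,1) for `V` is EXACTLY "finitely
many codimension-2 algebraic cycles on fourfolds `Y × C_j` carry `V`" (Grothendieck 1969 p. 301 made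
into an equivalence), and the negative bet is the heart S3. Intended witnesses: the hypergeometric
pencil `(1/4,1/3,2/3,3/4)` at `z = −2⁻⁴3⁻³` (`E = 32a`), `(1/3,1/3,2/3,2/3)` at `z = −2⁻³3⁻⁶`,
AESZ34 at `φ = −1/7` (`E = X₀(14)`) (Candelas–de la Ossa–Elmi–van Straten 2020 §6; Bönisch et al.
2024 §3.3), where no cycle is known. Why S3 might fail: GHC(3,1) is believed (it is HC for the
single class on `Y × E`); a Hulek–Verrill elliptic ruled surface `E × ℙ¹ ↪ Y` meeting the K3 fibres
would carry `V` (route kill criterion (a)).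

## Contents

* `CarriedBySurfaceGysin hY V`, `CarriedByCurveCorrespondences Y V` — the two transfer targets.
* the six registered stubs — S1, S2a, S2b₁, S2b₂, S2c CLOSED by the landed Theorems files (imported; the `stub_*` here are one-line aliases), `sorry` ONLY in the heart S3; `surjective_algebraic_corrAction_of_injective` (S2b₁ ∧ S2b₂ ⟹ S2b, PROVED glue);
* `carriedByCurveCorrespondences_of_transfers` — S1 ∧ S2a ∧ S2b ∧ S2c ⟹ `N¹H³(Y)` is carried by
  finitely many curve correspondences (PROVED glue);
* `ConiveauOneFailure_of` — the kernel-checked composition S1 → S2a → S2b₁ → S2b₂ → S2c → S3 → the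
  crux BY NAME, no `sorry`; `ConiveauOneFailure_of_stubs` — the crux modulo exactly the six stubs;
* PROVED sanity (tightness of the cut): `le_supportedClasses_of_carriedByCurveCorrespondences` (the
  converse transfer: algebraic curve correspondences land in `N¹H³`), whence
  `heart_of_unsupported_attractorPlane` (an attractor plane off `N¹H³` already gives the heart) and
  `not_heart_of_levelOneConiveauThreefolds` (GHC(3,1) + S1–S2 refute the heart: two-sided line).

Disproof used: none on file (`Cruxes/ConiveauOneFailure/` has no `Disproof.lean`, 2026-08-17).

## State after lead c2 (2026-08-17, gen 2c) — what is landed around the one open stub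

The stub set is UNCHANGED (one `sorry`: the heart S3, crux-equivalent by the landed Transfer
p150701). Landed `--supports` by lead c2 and imported here as one-line aliases (section "c2"):
* `Theorems/SecondaryPeriodsConiveauOneFailureInstrumentForm` (p152900 + append): the heart ⟺ its
  INSTRUMENT FORM — some CY-type threefold `Y` receives from some smooth projective curve `C` a
  rational type-`(1,1)` map `φ : H¹(C(ℂ)) → H³(Y(ℂ))` with `dim im φ = 2` which for NO orientation
  family is the action of an algebraic codimension-2 class on `Y ⊗ C` (the object of the route's
  Lemma A); instrument form ⟹ crux, ⟹ ¬HC; heart ⟺ ¬(rank-2 case of `AttractorPlanesConiveauOne`).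
* `Theorems/SecondaryPeriodsConiveauOneFailureHabitat` (p153168): the HABITAT is inhabited — every
  clause of the heart except the obstruction holds at the calibration threefold `E_i³`
  (rational rank-2 level-one sub-Hodge plane `⟨α₀β₀α₁, α₀β₀β₁⟩ ⊂ H³`, `h^{3,0} = 1`), from the tree's
  proved Künneth Hodge decomposition of `H³(E_τ³)`: the heart's whole content is the obstruction.
* `Theorems/SecondaryPeriodsConiveauOneFailureTightness` (p153729): the SUB-HODGE binder of the crux
  pair is load-bearing — GHC(3,1) WITHOUT it is false on `E_τ³` (Grothendieck 1969, barrier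
  `Grothendieck1969_generalHodgeConjecture_false_holds`), via the new lemma "a real class of `Fʳ Hᵏ`
  has Hodge coniveau `≥ r`"; so the crux is Grothendieck's AMENDED conjecture negated, not Hodge's
  original one (which fails for trivial reasons).
Faithfulness audit (NOTES.md of lead c2): the typed crux is neither junk-provable (Hodge models are
rigid: `hodgePQ_independent_of_hodgeModel_holds`) nor junk-refutable (`nonempty_hodgeModel_holds`;
`supportedClasses` uses Mathlib's `coheight` = codimension; `complexBetti` non-degenerate). What is
left is the open problem itself: a counterexample to GHC(3,1) = to HC on `Y × E` (verdict of both
leads: promote the heart).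

## State after lead c3 (2026-08-17, gen 2d) — the abelian sector of the habitat is excluded (mod Markman 2025)

The stub set is UNCHANGED (one `sorry`: the heart). Literature re-check of the bet (2024–2026): no
cycle published at a rational rank-2 attractor (kill criterion (a) has not fired), no non-algebraicity
certificate for a rational Hodge class; NEW: Markman 2025 (arXiv:2502.03415, 2509.23403 Cor. 1.3), the
Hodge conjecture for complex abelian varieties of dimension `≤ 5`, in the tree as the named claim
`Markman2025_hodgeClasses_algebraic_abelian_dim_le_five`. Landed `--supports` by lead c3 and imported
here as one-line aliases (section "c3"):
* `Theorems/SecondaryPeriodsConiveauOneFailureEllipticRealisation` (p163891) +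
  `…LevelOneReductionInClass` (p164505): rank-two Riemann WITH THE GROUP LAW REMEMBERED — a rank-2 rational
  level-one sub-Hodge plane of `H³(Y)` is `φ(H¹(E(ℂ)))` for a bundled one-dimensional
  `Motives.AbelianVariety ℂ` (the tree's reduction re-run with a class of curves threaded);
* `Theorems/SecondaryPeriodsConiveauOneFailureAbelianNoGo` (p165220): granted Markman 2025,
  **rank-two GHC(3,1) HOLDS on every threefold isomorphic to a complex abelian threefold** (Grothendieck's observation fires on the abelian FOURFOLD
  `A × E`: Voisin 11.41 + Markman + the transfer of this crux), so **a witness of the heart is not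
  (isomorphic to) an abelian threefold**, and at the route's calibration threefold `E_τ³ = cubeScheme τ hτ`
  (`= (E_τ × (E_τ × E_τ)).X` by `rfl`) no rank-2 plane is a witness — calibration kill criterion (c)
  in rank two. The negative bet therefore sits, as the route intended, at NON-abelian CY-type
  threefolds (the K3-fibred attractor pencils), where no case of HC on `Y × E` is known. Verdict of
  the third lead: promote the heart (instrument form, HEART-c2.md §4) and park the crux as an open
  problem.
-/

noncomputable section

namespace Summit.HodgeConjecture.HodgeConjecture.Cruxes.ConiveauOneFailure.Birth

open CategoryTheory MonoidalCategory CartesianMonoidalCategory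
open Literature.AlgebraicGeometry.Motives Literature.AlgebraicGeometry.HodgeTheory
  Literature.AlgebraicTopology.SingularHomology
open Summit.HodgeConjecture.HodgeConjecture.Theses.SecondaryPeriods (LevelOneConiveauThreefolds
  ConiveauOneFailure)

/-! ### The two transfer targets -/

/-- `V ⊆ H³(Y(ℂ); ℂ)` is **carried by Gysin images of finitely many smooth projective surfaces**:
for some orientation family `μ` there are finitely many smooth projective surfaces `S_j` with
morphisms `g_j : S_j → Y` such that `V ⊆ Σ_j g_{j*} H¹(S_j(ℂ); ℂ)` (Gysin maps
`complexGysin μ : H¹(S_j(ℂ)) → H³(Y(ℂ))`, `1 + 2·3 = 3 + 2·2`). The shape in which Deligne's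
Cor. 8.2.8 delivers `N¹H³(Y)` (the resolved surface components of one divisor).
[cite: DeligneHodgeIII1974, Cor. 8.2.8] -/
def CarriedBySurfaceGysin {Y : SchemeOver ℂ} (hY : IsSmoothProjective 3 Y)
    (V : Submodule ℂ (complexBetti Y 3)) : Prop :=
  ∃ (μ : OrientationFamily) (ι : Type) (_ : Finite ι) (S : ι → SchemeOver ℂ)
    (hS : ∀ j, IsSmoothProjective 2 (S j)) (g : ∀ j, S j ⟶ Y),
    V ≤ ⨆ j, LinearMap.range (complexGysin μ (hS j) hY (g j) (show 1 + 2 * 3 = 3 + 2 * 2 by norm_num))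

/-- `V ⊆ H³(Y(ℂ); ℂ)` is **carried by finitely many algebraic curve correspondences**: there are
finitely many smooth projective curves `C_j` and linear maps `T_j : H¹(C_j(ℂ); ℂ) → H³(Y(ℂ); ℂ)`,
each induced by an algebraic correspondence (`IsAlgebraicCorrespondence 3 1 Y (C j) (T j)`:
`T_j = [Z_j]_*`, `[Z_j] ∈ N²H⁴((Y ⊗ C_j)(ℂ))` algebraic — a codimension-2 cycle on the fourfold
`Y × C_j`), with `V ⊆ Σ_j im T_j` (Grothendieck's reformulation of the coniveau-one condition for `H³`
of a threefold, finite-family form). [cite: GrothendieckTopology1969, p. 301] -/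
def CarriedByCurveCorrespondences (Y : SchemeOver ℂ) (V : Submodule ℂ (complexBetti Y 3)) : Prop :=
  ∃ (ι : Type) (_ : Finite ι) (C : ι → SchemeOver ℂ) (_ : ∀ j, IsSmoothProjective 1 (C j))
    (T : ∀ j, complexBetti (C j) 1 →ₗ[ℂ] complexBetti Y 3),
    (∀ j, IsAlgebraicCorrespondence 3 1 Y (C j) (T j)) ∧ V ≤ ⨆ j, LinearMap.range (T j)

/-- Monotonicity of "carried by finitely many curve correspondences" in `V`. [folklore] -/
theorem CarriedByCurveCorrespondences.mono {Y : SchemeOver ℂ} {V W : Submodule ℂ (complexBetti Y 3)}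
    (hVW : V ≤ W) (h : CarriedByCurveCorrespondences Y W) : CarriedByCurveCorrespondences Y V := by
  obtain ⟨ι, hι, C, hC, T, hT, hle⟩ := h
  exact ⟨ι, hι, C, hC, T, hT, hVW.trans hle⟩

/-! ### The six registered stubs — five LANDED (wave 1, 2026-08-17: p147543, p147547, p148956, p147675, p147752), `sorry` only in the heart S3 -/

/-- STUB S1 (known in print, inputs discharged in the tree; M) — **coniveau-one classes of a smooth
projective threefold are carried by Gysin images of finitely many smooth projective surfaces.**
`N¹H³(Y) = ⨆_Z ker(H³(Y) → H³(Y ∖ Z))` over divisors `Z`; by finite-dimensionality of `H³(Y(ℂ))`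
(`finite_complexBetti`) and monotonicity in `Z` (`complexBetti.restrictCompl_eq_zero_of_subset`) it
is `ker(H³(Y) → H³(Y ∖ Z₀))` for ONE divisor `Z₀`; `exists_equidim_family_iUnion_range_eq` (Hironaka
on the components, DISCHARGED) writes `Z₀ = ⋃_j g_j(S_j)` with `S_j` smooth projective surfaces;
Deligne, Hodge III Cor. 8.2.8 (DISCHARGED: `Deligne1974_ker_restrictCompl_eq_iSup_range_complexGysin_holds`,
unfolded by `….mem_iSup_range_of_iUnion_range_eq`, `OrientationFamily.hasPoincareDuality`) gives
`ker = ⨆_j ⨆_a ⨆_{a + 6 = 3 + 4} im g_{j*}`, and only `a = 1` occurs. Why it might fail: it does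
not (every input is a theorem of the tree). [cite: DeligneHodgeIII1974, Cor. 8.2.8]
[cite: GrothendieckTopology1969, p. 300] -/
theorem stub_supportedClasses_le_surfaceGysin :
    ∀ ⦃Y : SchemeOver ℂ⦄ (hY : IsSmoothProjective 3 Y),
      ∃ (μ : OrientationFamily) (ι : Type) (_ : Finite ι) (S : ι → SchemeOver ℂ)
        (hS : ∀ j, IsSmoothProjective 2 (S j)) (g : ∀ j, S j ⟶ Y),
        supportedClasses Y 3 1 ≤
          ⨆ j, LinearMap.range
            (complexGysin μ (hS j) hY (g j) (show 1 + 2 * 3 = 3 + 2 * 2 by norm_num)) :=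
  Summit.HodgeConjecture.HodgeConjecture.Theorems.stub_supportedClasses_le_surfaceGysin

/-- STUB S2a (known in print, inputs discharged in the tree; S) — **a curve on every surface,
injective on `H¹`.** Every smooth projective surface `S/ℂ` receives a morphism `i : C → S` from a
smooth projective curve `C` with `i^* : H¹(S(ℂ); ℂ) → H¹(C(ℂ); ℂ)` injective: a smooth member
`C = π⁻¹(t)` of a Lefschetz pencil of hyperplane sections, mapped through the blow-down
(`exists_fiberNet_pencil_weakLefschetz_holds` with `r = 1`, PROVED: weak Lefschetz in degree `r`;
a complex point of the smooth base exists by `FiberNet.smoothBase_nonempty_of_charZero` /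
the discriminant being a proper closed subset, and the fibre is a smooth projective curve by
`FiberNet.isSmoothProjective_fiber_of_mem_smoothBase`). Why it might fail: only through a mismatch
between `IsSmoothProjective 2 S` and the fact's `IsSmoothProjective (1 + 1) S` (definitional).
[cite: VoisinHodgeII2003, §1.2.2 Thm. 1.23 and §2.1.1] -/
theorem stub_curveOnSurface_injective :
    ∀ ⦃S : SchemeOver ℂ⦄, IsSmoothProjective 2 S →
      ∃ (C : SchemeOver ℂ) (_ : IsSmoothProjective 1 C) (i : C ⟶ S),
        Function.Injective (complexBetti.map i 1) :=
  Summit.HodgeConjecture.HodgeConjecture.Theorems.stub_curveOnSurface_injective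

/-- STUB S2b₁ (known in print; L) — **an injective restriction `H¹(S) ↪ H¹(C)` is split by a
surjective HODGE map `H¹(C) ↠ H¹(S)`.** For a smooth projective surface `S`, a smooth projective
curve `C` and `i : C → S` with `i^*` injective on `H¹(S(ℂ); ℂ)`, there are Hodge models `A` of `S`,
`B` of `C` and a SURJECTIVE `ℂ`-linear `φ : H¹(C(ℂ); ℂ) ↠ H¹(S(ℂ); ℂ)` sending rational classes to
rational classes and classes of type `(p,q)` (read in `B`) to classes of type `(p,q)` (read in
`A`) — the two hypotheses of Voisin I Lemma 11.41 in the tree's form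
(`exists_rational_hodgeClass_corrAction_eq_smul`, `r = 0`). Proof in print: `i^* : H¹(S, ℚ) →
H¹(C, ℚ)` is an injective morphism of polarisable weight-one Hodge structures (tree:
`HodgeModel.hodgeStructure`, `HodgeModel.hodgeStructureHom`, `hodgePQ_independent_of_hodgeModel_holds`,
real models `exists_isReal_hodgeModel_holds`, `smoothProjective_hodgeStructure_isPolarizable_holds`);
polarisable Hodge structures are semisimple (`Motives.SubHodgeStructure.exists_isCompl`,
`….exists_isCompl_eq_orthogonal`, `Hom.exists_subHodgeStructure_range`), so `i^*` has a retraction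
`ρ`, a morphism of Hodge structures (morphisms of pure Hodge structures of equal weight are strict);
`φ = β_S ∘ (ρ ⊗ ℂ) ∘ β_C⁻¹` (`ofRatClassBaseChangeEquiv`, `HodgeModel.complexification`,
`Hom.map_piece_le`, `piece_eq_ratPiece`; pattern: the proof of
`exists_weightOne_form_of_levelOne_subHodge`, steps 4–6). Alternative in print: `φ = L⁻¹ ∘ i_*`
(Gysin + hard Lefschetz on `S`, `i_*` onto because `i^*` is into, by Poincaré duality). Why it might
fail: it does not in print; in the tree the retraction/strictness lemma for `Motives.HodgeStructure.Hom`
and the abstract-`Hom` → concrete-`φ` conversion are not yet packaged as statements.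
[cite: VoisinHodgeI2002, §7.3.1 Def. 7.22–7.24, Lemma 7.26 and §7.1.2] [cite: GrothendieckTopology1969, p. 301] -/
theorem stub_surjective_hodgeMap_of_injective :
    ∀ ⦃S C : SchemeOver ℂ⦄ (hS : IsSmoothProjective 2 S) (hC : IsSmoothProjective 1 C) (i : C ⟶ S),
      Function.Injective (complexBetti.map i 1) →
        ∃ (A : HodgeModel 2 S) (B : HodgeModel 1 C) (φ : complexBetti C 1 →ₗ[ℂ] complexBetti S 1),
          (∀ c, IsRationalClass c → IsRationalClass (φ c)) ∧
          (∀ (p q : ℕ), p + q = 1 → ∀ c, B.pullback 1 c ∈ B.hodgePQ 1 p q →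
            A.pullback 1 (φ c) ∈ A.hodgePQ 1 p q) ∧
          Function.Surjective φ :=
  Summit.HodgeConjecture.HodgeConjecture.Theorems.stub_surjective_hodgeMap_of_injective

/-- STUB S2b₂ (known in print, inputs discharged in the tree; S) — **a surjective Hodge map
`H¹(C) ↠ H¹(S)` is, up to a non-zero scalar, the action of an ALGEBRAIC divisor class on `S ⊗ C`.**
For `φ : H¹(C(ℂ); ℂ) ↠ H¹(S(ℂ); ℂ)` rational and of type `(0,0)` w.r.t. Hodge models `B`, `A`,
and every orientation family `μ`: Voisin I Lemma 11.41 (`exists_rational_hodgeClass_corrAction_eq_smul hS hC A B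
(hab : 1 + 2·1 = 1 + 2·1) (hr : 1 + 0 = 1) φ hφ hφH μ`) gives a rational class `γ ∈ H²((S ⊗ C)(ℂ))`
of Hodge type `(1,1)` with `corrAction μ hS hC hab γ = t • φ`, `t ≠ 0`; Lefschetz `(1,1)`
(`lefschetzOneOne_rational_holds (IsSmoothProjective.tensor_holds hS hC) γ`) makes `γ ∈ N¹H²`
algebraic; `t • φ` is onto. Why it might fail: it does not (only the `(p + 0, q + 0)` vs `(p, q)`
bookkeeping of `hφH`). [cite: VoisinHodgeI2002, §11.3.3 Lemma 11.41 and Thm. 11.30 (Lefschetz (1,1))] -/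
theorem stub_surjective_algebraic_corrAction_of_hodgeMap :
    ∀ ⦃S C : SchemeOver ℂ⦄ (hS : IsSmoothProjective 2 S) (hC : IsSmoothProjective 1 C)
      (A : HodgeModel 2 S) (B : HodgeModel 1 C) (φ : complexBetti C 1 →ₗ[ℂ] complexBetti S 1),
      (∀ c, IsRationalClass c → IsRationalClass (φ c)) →
      (∀ (p q : ℕ), p + q = 1 → ∀ c, B.pullback 1 c ∈ B.hodgePQ 1 p q →
        A.pullback 1 (φ c) ∈ A.hodgePQ 1 p q) →
      Function.Surjective φ → ∀ μ : OrientationFamily,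
        ∃ γ ∈ algebraicClasses (S ⊗ C) 1,
          Function.Surjective (corrAction μ hS hC (show 1 + 2 * 1 = 1 + 2 * 1 from rfl) γ) :=
  Summit.HodgeConjecture.HodgeConjecture.Theorems.stub_surjective_algebraic_corrAction_of_hodgeMap

/-- **S2b (PROVED glue of S2b₁ and S2b₂)**: an injective restriction `H¹(S) ↪ H¹(C)` is split by a
surjective ALGEBRAIC correspondence `[γ]_* : H¹(C(ℂ)) ↠ H¹(S(ℂ))`, `γ ∈ N¹H²((S ⊗ C)(ℂ))`.
[cite: VoisinHodgeI2002, §11.3.3 Lemma 11.41] -/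
theorem surjective_algebraic_corrAction_of_injective
    (h₁ : ∀ ⦃S C : SchemeOver ℂ⦄ (hS : IsSmoothProjective 2 S) (hC : IsSmoothProjective 1 C)
      (i : C ⟶ S), Function.Injective (complexBetti.map i 1) →
        ∃ (A : HodgeModel 2 S) (B : HodgeModel 1 C) (φ : complexBetti C 1 →ₗ[ℂ] complexBetti S 1),
          (∀ c, IsRationalClass c → IsRationalClass (φ c)) ∧
          (∀ (p q : ℕ), p + q = 1 → ∀ c, B.pullback 1 c ∈ B.hodgePQ 1 p q →
            A.pullback 1 (φ c) ∈ A.hodgePQ 1 p q) ∧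
          Function.Surjective φ)
    (h₂ : ∀ ⦃S C : SchemeOver ℂ⦄ (hS : IsSmoothProjective 2 S) (hC : IsSmoothProjective 1 C)
      (A : HodgeModel 2 S) (B : HodgeModel 1 C) (φ : complexBetti C 1 →ₗ[ℂ] complexBetti S 1),
      (∀ c, IsRationalClass c → IsRationalClass (φ c)) →
      (∀ (p q : ℕ), p + q = 1 → ∀ c, B.pullback 1 c ∈ B.hodgePQ 1 p q →
        A.pullback 1 (φ c) ∈ A.hodgePQ 1 p q) →
      Function.Surjective φ → ∀ μ : OrientationFamily,
        ∃ γ ∈ algebraicClasses (S ⊗ C) 1,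
          Function.Surjective (corrAction μ hS hC (show 1 + 2 * 1 = 1 + 2 * 1 from rfl) γ))
    ⦃S C : SchemeOver ℂ⦄ (hS : IsSmoothProjective 2 S) (hC : IsSmoothProjective 1 C) (i : C ⟶ S)
    (hi : Function.Injective (complexBetti.map i 1)) (μ : OrientationFamily) :
    ∃ γ ∈ algebraicClasses (S ⊗ C) 1,
      Function.Surjective (corrAction μ hS hC (show 1 + 2 * 1 = 1 + 2 * 1 from rfl) γ) := by
  obtain ⟨A, B, φ, hφ, hφH, hsurj⟩ := h₁ hS hC i hi
  exact h₂ hS hC A B φ hφ hφH hsurj μ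

/-- STUB S2c (known in print, inputs proved in the tree; S–M) — **Gysin ∘ algebraic correspondence
is an algebraic correspondence.** For `g : S → Y` (surface to threefold), a curve `C` and an
algebraic class `γ ∈ N¹H²((S ⊗ C)(ℂ))`: `g_* ∘ [γ]_* = [(g ⊗ 𝟙_C)_* γ]_* : H¹(C(ℂ)) → H³(Y(ℂ))`
with `(g ⊗ 𝟙_C)_* γ ∈ N²H⁴((Y ⊗ C)(ℂ))` algebraic — for `x ∈ H¹(C)`:
`g_* pr_{S*}(pr_C^* x ∪ γ) = pr_{Y*}(g ⊗ 𝟙)_*((g ⊗ 𝟙)^* pr_C^* x ∪ γ) = pr_{Y*}(pr_C^* x ∪ (g ⊗ 𝟙)_* γ)`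
(`corrAction_apply`, `complexGysin_comp` twice with `whiskerRight_fst : (g ▷ C) ≫ fst = fst ≫ g`,
`whiskerRight_snd`, `complexBetti.map_comp`, projection formula `complexGysin_cup`,
`complexGysin_mem_algebraicClasses` with `gysinMap_restrictCompl_eq_zero_of_field ℂ`,
`isAlgebraicCorrespondence_corrAction`, `OrientationFamily.hasPoincareDuality`). Why it might fail:
it does not (Fulton, Intersection Theory, Prop. 16.1.1 (c) with a graph; every input is a theorem of
the tree). [cite: Fulton1998, §16.1 Prop. 16.1.1] [cite: FultonYoungTableaux1997, Appendix B §B.1 (5)–(6)] -/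
theorem stub_isAlgebraicCorrespondence_gysin_comp_corrAction :
    ∀ (μ : OrientationFamily) ⦃Y S C : SchemeOver ℂ⦄ (hY : IsSmoothProjective 3 Y)
      (hS : IsSmoothProjective 2 S) (hC : IsSmoothProjective 1 C) (g : S ⟶ Y)
      (γ : complexBetti (S ⊗ C) (2 * 1)), γ ∈ algebraicClasses (S ⊗ C) 1 →
        IsAlgebraicCorrespondence 3 1 Y C
          (complexGysin μ hS hY g (show 1 + 2 * 3 = 3 + 2 * 2 by norm_num) ∘ₗ
            corrAction μ hS hC (show 1 + 2 * 1 = 1 + 2 * 1 from rfl) γ) :=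
  Summit.HodgeConjecture.HodgeConjecture.Theorems.stub_isAlgebraicCorrespondence_gysin_comp_corrAction

/-- STUB S3 (THE HEART; open — the negative bet in its cycle form) — **an attractor plane off all
finite families of curve correspondences**: there is a smooth projective threefold `Y` of
Calabi–Yau type (`h^{3,0}(Y) = 1`) with a finite set `s` of rational classes whose `ℂ`-span `V` is a
sub-Hodge structure of `H³(Y(ℂ))` (stable under the type decomposition of a Hodge model `A`) of
level one (`V ⊆ H^{2,1} ⊕ H^{1,2}`) and of rank `2` — a rational rank-2 attractor plane
`V ≅ H¹(E)(−1)` — such that NO finite family of algebraic correspondences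
`[Z_j]_* : H¹(C_j(ℂ)) → H³(Y(ℂ))`, `C_j` smooth projective curves, `Z_j` codimension-2 algebraic
classes on `Y ⊗ C_j`, has `V ⊆ Σ_j im [Z_j]_*`. Intended witnesses: the hypergeometric pencil
`(1/4,1/3,2/3,3/4)` at `z = −2⁻⁴3⁻³` (`E = 32a`), `(1/3,1/3,2/3,2/3)` at `z = −2⁻³3⁻⁶`, AESZ34 at
`φ = −1/7` (`E = X₀(14)`), where no cycle is known. Equivalent, modulo S1–S2 and the proved converse
transfer, to the habitat instance `V ⊄ N¹H³(Y)` of the crux (an open problem). Why it might fail: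
GHC(3,1) is believed (it is HC for the single class on `Y × E`); a Hulek–Verrill elliptic ruled
surface `E × ℙ¹ ↪ Y` meeting the K3 fibres would carry `V` (route kill criterion (a)).
[cite: CandelasEtAl2020, §6] [cite: BonischEtAl2024, §3.3] [cite: GrothendieckTopology1969, p. 301]
[cite: HulekVerrill2006, §2] -/
theorem stub_attractorPlane_offCurveCorrespondences :
    ∃ (Y : SchemeOver ℂ) (_ : IsSmoothProjective 3 Y) (A : HodgeModel 3 Y)
      (s : Finset (complexBetti Y 3)),
      (∀ c ∈ s, IsRationalClass c) ∧
      (Submodule.span ℂ (↑s : Set (complexBetti Y 3))).map (A.pullback 3).hom =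
        (⨆ (p : ℕ) (q : ℕ) (_ : p + q = 3),
          (Submodule.span ℂ (↑s : Set (complexBetti Y 3))).map (A.pullback 3).hom ⊓
            A.hodgePQ 3 p q) ∧
      (Submodule.span ℂ (↑s : Set (complexBetti Y 3))).map (A.pullback 3).hom ≤
        (⨆ (p : ℕ) (q : ℕ) (_ : p + q = 3) (_ : 1 ≤ p) (_ : 1 ≤ q), A.hodgePQ 3 p q) ∧
      Module.finrank ℂ (A.hodgePQ 3 3 0) = 1 ∧
      Module.finrank ℂ (Submodule.span ℂ (↑s : Set (complexBetti Y 3))) = 2 ∧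
      ¬ CarriedByCurveCorrespondences Y (Submodule.span ℂ (↑s : Set (complexBetti Y 3))) := by
  sorry

/-! ### Proved glue: the transfers S1 ∧ S2a ∧ S2b ∧ S2c put `N¹H³(Y)` on the cycle side -/

/-- **The transfer (PROVED glue).** If `N¹H³` of every smooth projective threefold is carried by
Gysin images of finitely many surfaces (S1), every surface has a curve injective on `H¹` (S2a),
such an injection is split by a surjective algebraic correspondence (S2b), and Gysin ∘ algebraic
correspondence is algebraic (S2c), then `N¹H³(Y)` is carried by finitely many algebraic curve
correspondences: `im g_{j*} = im (g_{j*} ∘ [γ_j]_*)` because `[γ_j]_*` is onto. [folklore] -/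
theorem carriedByCurveCorrespondences_of_transfers
    (h₁ : ∀ ⦃Y : SchemeOver ℂ⦄ (hY : IsSmoothProjective 3 Y),
      ∃ (μ : OrientationFamily) (ι : Type) (_ : Finite ι) (S : ι → SchemeOver ℂ)
        (hS : ∀ j, IsSmoothProjective 2 (S j)) (g : ∀ j, S j ⟶ Y),
        supportedClasses Y 3 1 ≤
          ⨆ j, LinearMap.range
            (complexGysin μ (hS j) hY (g j) (show 1 + 2 * 3 = 3 + 2 * 2 by norm_num)))
    (h₂ : ∀ ⦃S : SchemeOver ℂ⦄, IsSmoothProjective 2 S →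
      ∃ (C : SchemeOver ℂ) (_ : IsSmoothProjective 1 C) (i : C ⟶ S),
        Function.Injective (complexBetti.map i 1))
    (h₃ : ∀ ⦃S C : SchemeOver ℂ⦄ (hS : IsSmoothProjective 2 S) (hC : IsSmoothProjective 1 C)
      (i : C ⟶ S), Function.Injective (complexBetti.map i 1) → ∀ μ : OrientationFamily,
        ∃ γ ∈ algebraicClasses (S ⊗ C) 1,
          Function.Surjective (corrAction μ hS hC (show 1 + 2 * 1 = 1 + 2 * 1 from rfl) γ))
    (h₄ : ∀ (μ : OrientationFamily) ⦃Y S C : SchemeOver ℂ⦄ (hY : IsSmoothProjective 3 Y)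
      (hS : IsSmoothProjective 2 S) (hC : IsSmoothProjective 1 C) (g : S ⟶ Y)
      (γ : complexBetti (S ⊗ C) (2 * 1)), γ ∈ algebraicClasses (S ⊗ C) 1 →
        IsAlgebraicCorrespondence 3 1 Y C
          (complexGysin μ hS hY g (show 1 + 2 * 3 = 3 + 2 * 2 by norm_num) ∘ₗ
            corrAction μ hS hC (show 1 + 2 * 1 = 1 + 2 * 1 from rfl) γ))
    ⦃Y : SchemeOver ℂ⦄ (hY : IsSmoothProjective 3 Y) :
    CarriedByCurveCorrespondences Y (supportedClasses Y 3 1) := by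
  obtain ⟨μ, ι, hι, S, hS, g, hle⟩ := h₁ hY
  choose C hC i hi using fun j ↦ h₂ (hS j)
  choose γ hγ hsurj using fun j ↦ h₃ (hS j) (hC j) (i j) (hi j) μ
  refine ⟨ι, hι, C, hC, fun j ↦
    complexGysin μ (hS j) hY (g j) (show 1 + 2 * 3 = 3 + 2 * 2 by norm_num) ∘ₗ
      corrAction μ (hS j) (hC j) (show 1 + 2 * 1 = 1 + 2 * 1 from rfl) (γ j),
    fun j ↦ h₄ μ hY (hS j) (hC j) (g j) (γ j) (hγ j), hle.trans (iSup_mono fun j ↦ ?_)⟩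
  rw [LinearMap.range_comp_of_range_eq_top _ (LinearMap.range_eq_top.2 (hsurj j))]

/-! ### The composition: S1 → S2a → S2b → S2c → S3 → the crux, by name -/

/-- **THE LINE'S COMPOSITION** (kernel-checked, no `sorry`): granted the four transfer stubs, the
heart S3 gives `ConiveauOneFailure`: at the witness, GHC(3,1) would put `V` inside `N¹H³(Y)`, hence
(transfer) inside a finite sum of images of algebraic curve correspondences — contradiction.
[folklore] -/
theorem ConiveauOneFailure_of
    (h₁ : ∀ ⦃Y : SchemeOver ℂ⦄ (hY : IsSmoothProjective 3 Y),
      ∃ (μ : OrientationFamily) (ι : Type) (_ : Finite ι) (S : ι → SchemeOver ℂ)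
        (hS : ∀ j, IsSmoothProjective 2 (S j)) (g : ∀ j, S j ⟶ Y),
        supportedClasses Y 3 1 ≤
          ⨆ j, LinearMap.range
            (complexGysin μ (hS j) hY (g j) (show 1 + 2 * 3 = 3 + 2 * 2 by norm_num)))
    (h₂ : ∀ ⦃S : SchemeOver ℂ⦄, IsSmoothProjective 2 S →
      ∃ (C : SchemeOver ℂ) (_ : IsSmoothProjective 1 C) (i : C ⟶ S),
        Function.Injective (complexBetti.map i 1))
    (h₃₁ : ∀ ⦃S C : SchemeOver ℂ⦄ (hS : IsSmoothProjective 2 S) (hC : IsSmoothProjective 1 C)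
      (i : C ⟶ S), Function.Injective (complexBetti.map i 1) →
        ∃ (A : HodgeModel 2 S) (B : HodgeModel 1 C) (φ : complexBetti C 1 →ₗ[ℂ] complexBetti S 1),
          (∀ c, IsRationalClass c → IsRationalClass (φ c)) ∧
          (∀ (p q : ℕ), p + q = 1 → ∀ c, B.pullback 1 c ∈ B.hodgePQ 1 p q →
            A.pullback 1 (φ c) ∈ A.hodgePQ 1 p q) ∧
          Function.Surjective φ)
    (h₃₂ : ∀ ⦃S C : SchemeOver ℂ⦄ (hS : IsSmoothProjective 2 S) (hC : IsSmoothProjective 1 C)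
      (A : HodgeModel 2 S) (B : HodgeModel 1 C) (φ : complexBetti C 1 →ₗ[ℂ] complexBetti S 1),
      (∀ c, IsRationalClass c → IsRationalClass (φ c)) →
      (∀ (p q : ℕ), p + q = 1 → ∀ c, B.pullback 1 c ∈ B.hodgePQ 1 p q →
        A.pullback 1 (φ c) ∈ A.hodgePQ 1 p q) →
      Function.Surjective φ → ∀ μ : OrientationFamily,
        ∃ γ ∈ algebraicClasses (S ⊗ C) 1,
          Function.Surjective (corrAction μ hS hC (show 1 + 2 * 1 = 1 + 2 * 1 from rfl) γ))
    (h₄ : ∀ (μ : OrientationFamily) ⦃Y S C : SchemeOver ℂ⦄ (hY : IsSmoothProjective 3 Y)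
      (hS : IsSmoothProjective 2 S) (hC : IsSmoothProjective 1 C) (g : S ⟶ Y)
      (γ : complexBetti (S ⊗ C) (2 * 1)), γ ∈ algebraicClasses (S ⊗ C) 1 →
        IsAlgebraicCorrespondence 3 1 Y C
          (complexGysin μ hS hY g (show 1 + 2 * 3 = 3 + 2 * 2 by norm_num) ∘ₗ
            corrAction μ hS hC (show 1 + 2 * 1 = 1 + 2 * 1 from rfl) γ))
    (h₅ : ∃ (Y : SchemeOver ℂ) (_ : IsSmoothProjective 3 Y) (A : HodgeModel 3 Y)
      (s : Finset (complexBetti Y 3)),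
      (∀ c ∈ s, IsRationalClass c) ∧
      (Submodule.span ℂ (↑s : Set (complexBetti Y 3))).map (A.pullback 3).hom =
        (⨆ (p : ℕ) (q : ℕ) (_ : p + q = 3),
          (Submodule.span ℂ (↑s : Set (complexBetti Y 3))).map (A.pullback 3).hom ⊓
            A.hodgePQ 3 p q) ∧
      (Submodule.span ℂ (↑s : Set (complexBetti Y 3))).map (A.pullback 3).hom ≤
        (⨆ (p : ℕ) (q : ℕ) (_ : p + q = 3) (_ : 1 ≤ p) (_ : 1 ≤ q), A.hodgePQ 3 p q) ∧
      Module.finrank ℂ (A.hodgePQ 3 3 0) = 1 ∧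
      Module.finrank ℂ (Submodule.span ℂ (↑s : Set (complexBetti Y 3))) = 2 ∧
      ¬ CarriedByCurveCorrespondences Y (Submodule.span ℂ (↑s : Set (complexBetti Y 3)))) :
    Summit.HodgeConjecture.HodgeConjecture.Theses.SecondaryPeriods.ConiveauOneFailure := by
  obtain ⟨Y, hY, A, s, hs, hsub, hlev, -, -, hoff⟩ := h₅
  intro hG
  exact hoff ((carriedByCurveCorrespondences_of_transfers h₁ h₂
    (surjective_algebraic_corrAction_of_injective h₃₁ h₃₂) h₄ hY).mono (hG hY A s hs hsub hlev))

/-- **The crux, closed modulo exactly the six registered stubs.** -/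
theorem ConiveauOneFailure_of_stubs :
    Summit.HodgeConjecture.HodgeConjecture.Theses.SecondaryPeriods.ConiveauOneFailure :=
  ConiveauOneFailure_of stub_supportedClasses_le_surfaceGysin stub_curveOnSurface_injective
    stub_surjective_hodgeMap_of_injective stub_surjective_algebraic_corrAction_of_hodgeMap
    stub_isAlgebraicCorrespondence_gysin_comp_corrAction stub_attractorPlane_offCurveCorrespondences

/-! ### Proved sanity: the converse transfer (tightness of the cut) -/

/-- **Cup product with a class supported in codimension `≥ r` is supported in codimension `≥ r`**
(naturality of `∪` under restriction to `(X ∖ Z)(ℂ)`). [cite: GrothendieckTopology1969, §1] -/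
theorem cupProduct_mem_supportedClasses_of_right {X : SchemeOver ℂ} {p q k : ℕ} (hpq : p + q = k)
    {r : ℕ} (x : complexBetti X p) {γ : complexBetti X q} (hγ : γ ∈ supportedClasses X q r) :
    cupProduct hpq x γ ∈ supportedClasses X k r := by
  suffices h : supportedClasses X q r ≤ (supportedClasses X k r).comap (cupProduct hpq x) from h hγ
  refine iSup_le fun Z ↦ iSup_le fun hZ ↦ iSup_le fun hr ↦ fun γ' hγ' ↦ ?_
  rw [Submodule.mem_comap]
  refine mem_supportedClasses_of_restrictCompl_eq_zero hZ hr ?_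
  rw [LinearMap.mem_ker] at hγ'
  change singularCohomology.map ℂ ℂ _ k (cupProduct hpq x γ') = 0
  rw [cupProduct_map]
  change cupProduct hpq _ (complexBetti.restrictCompl X Z q γ') = 0
  rw [hγ', map_zero]

/-- **The converse transfer (PROVED): the images of algebraic curve correspondences lie in
`N¹H³(Y)`.** For `T = [γ]_* = pr_{Y*}(pr_C^*(·) ∪ γ)` with `γ ∈ N²H⁴((Y ⊗ C)(ℂ))`:
`pr_C^* c ∪ γ ∈ N²H⁵` and the Gysin map of `pr_Y : Y ⊗ C → Y` (relative dimension `1`) lowers the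
codimension of supports by one (`gysinMap_mem_supportedClasses_of_isSmoothProjective`); a finite
sum of supported classes is supported. [cite: GrothendieckTopology1969, p. 301]
[cite: FultonYoungTableaux1997, Appendix B §B.2 Exercise 5] -/
theorem le_supportedClasses_of_carriedByCurveCorrespondences {Y : SchemeOver ℂ}
    (hY : IsSmoothProjective 3 Y) {V : Submodule ℂ (complexBetti Y 3)}
    (h : CarriedByCurveCorrespondences Y V) : V ≤ supportedClasses Y 3 1 := by
  obtain ⟨ι, -, C, hC, T, hT, hle⟩ := h
  refine hle.trans (iSup_le fun j ↦ ?_)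
  obtain ⟨μ, ν, hμ, hν, e, q, hab, hq, γ, hγ, hTj⟩ := hT j
  rw [← hTj]
  rintro _ ⟨c, rfl⟩
  obtain rfl : e = 2 := by omega
  obtain rfl : q = 3 := by omega
  rw [corrClassAction_apply]
  exact gysinMap_mem_supportedClasses_of_isSmoothProjective
    (IsSmoothProjective.tensor_holds hY (hC j)) hY μ ν hν (fst Y (C j)) _ hq
    (show 1 + (3 + 1) ≤ 3 + 2 by norm_num) (cupProduct_mem_supportedClasses_of_right rfl _ hγ)

/-- **An attractor plane off `N¹H³` already gives the heart (PROVED)**: S3 is implied by the habitat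
instance of the crux (`¬ V ⊆ N¹H³(Y)` for a rank-2 rational level-one plane on a threefold of
Calabi–Yau type), by the converse transfer; with `ConiveauOneFailure_of` this shows the heart is the
crux transferred to the cycle side, neither weaker vocabulary nor a restatement.
[cite: GrothendieckTopology1969, p. 301] -/
theorem heart_of_unsupported_attractorPlane
    (h : ∃ (Y : SchemeOver ℂ) (_ : IsSmoothProjective 3 Y) (A : HodgeModel 3 Y)
      (s : Finset (complexBetti Y 3)),
      (∀ c ∈ s, IsRationalClass c) ∧
      (Submodule.span ℂ (↑s : Set (complexBetti Y 3))).map (A.pullback 3).hom =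
        (⨆ (p : ℕ) (q : ℕ) (_ : p + q = 3),
          (Submodule.span ℂ (↑s : Set (complexBetti Y 3))).map (A.pullback 3).hom ⊓
            A.hodgePQ 3 p q) ∧
      (Submodule.span ℂ (↑s : Set (complexBetti Y 3))).map (A.pullback 3).hom ≤
        (⨆ (p : ℕ) (q : ℕ) (_ : p + q = 3) (_ : 1 ≤ p) (_ : 1 ≤ q), A.hodgePQ 3 p q) ∧
      Module.finrank ℂ (A.hodgePQ 3 3 0) = 1 ∧
      Module.finrank ℂ (Submodule.span ℂ (↑s : Set (complexBetti Y 3))) = 2 ∧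
      ¬ Submodule.span ℂ (↑s : Set (complexBetti Y 3)) ≤ supportedClasses Y 3 1) :
    ∃ (Y : SchemeOver ℂ) (_ : IsSmoothProjective 3 Y) (A : HodgeModel 3 Y)
      (s : Finset (complexBetti Y 3)),
      (∀ c ∈ s, IsRationalClass c) ∧
      (Submodule.span ℂ (↑s : Set (complexBetti Y 3))).map (A.pullback 3).hom =
        (⨆ (p : ℕ) (q : ℕ) (_ : p + q = 3),
          (Submodule.span ℂ (↑s : Set (complexBetti Y 3))).map (A.pullback 3).hom ⊓
            A.hodgePQ 3 p q) ∧
      (Submodule.span ℂ (↑s : Set (complexBetti Y 3))).map (A.pullback 3).hom ≤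
        (⨆ (p : ℕ) (q : ℕ) (_ : p + q = 3) (_ : 1 ≤ p) (_ : 1 ≤ q), A.hodgePQ 3 p q) ∧
      Module.finrank ℂ (A.hodgePQ 3 3 0) = 1 ∧
      Module.finrank ℂ (Submodule.span ℂ (↑s : Set (complexBetti Y 3))) = 2 ∧
      ¬ CarriedByCurveCorrespondences Y (Submodule.span ℂ (↑s : Set (complexBetti Y 3))) := by
  obtain ⟨Y, hY, A, s, hs, hsub, hlev, h30, hrk, hns⟩ := h
  exact ⟨Y, hY, A, s, hs, hsub, hlev, h30, hrk,
    fun hcar ↦ hns (le_supportedClasses_of_carriedByCurveCorrespondences hY hcar)⟩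

/-- **GHC(3,1) refutes the heart (PROVED)**: the positive crux `LevelOneConiveauThreefolds` and the
four transfer stubs together contradict S3 — the line is two-sided exactly like the route (kill
criterion (a): a proof of GHC(3,1), or a surface carrying the attractor plane, kills the line).
[cite: GrothendieckTopology1969, p. 301] -/
theorem not_heart_of_levelOneConiveauThreefolds (hG : LevelOneConiveauThreefolds)
    (h : ∀ ⦃Y : SchemeOver ℂ⦄ (hY : IsSmoothProjective 3 Y),
      CarriedByCurveCorrespondences Y (supportedClasses Y 3 1)) :
    ¬ ∃ (Y : SchemeOver ℂ) (_ : IsSmoothProjective 3 Y) (A : HodgeModel 3 Y)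
      (s : Finset (complexBetti Y 3)),
      (∀ c ∈ s, IsRationalClass c) ∧
      (Submodule.span ℂ (↑s : Set (complexBetti Y 3))).map (A.pullback 3).hom =
        (⨆ (p : ℕ) (q : ℕ) (_ : p + q = 3),
          (Submodule.span ℂ (↑s : Set (complexBetti Y 3))).map (A.pullback 3).hom ⊓
            A.hodgePQ 3 p q) ∧
      (Submodule.span ℂ (↑s : Set (complexBetti Y 3))).map (A.pullback 3).hom ≤
        (⨆ (p : ℕ) (q : ℕ) (_ : p + q = 3) (_ : 1 ≤ p) (_ : 1 ≤ q), A.hodgePQ 3 p q) ∧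
      Module.finrank ℂ (A.hodgePQ 3 3 0) = 1 ∧
      Module.finrank ℂ (Submodule.span ℂ (↑s : Set (complexBetti Y 3))) = 2 ∧
      ¬ CarriedByCurveCorrespondences Y (Submodule.span ℂ (↑s : Set (complexBetti Y 3))) := by
  rintro ⟨Y, hY, A, s, hs, hsub, hlev, -, -, hoff⟩
  exact hoff ((h hY).mono (hG hY A s hs hsub hlev))

/-! ### Lead c2 (gen 2c): the heart in instrument form, the inhabited habitat, tightness — all LANDED, aliases -/

/-- **The heart ⟺ its instrument form** (LANDED, p152900,
`Theorems/SecondaryPeriodsConiveauOneFailureInstrumentForm`): the registered heart S3 holds iff some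
Calabi–Yau-type threefold receives a rational type-`(1,1)` curve correspondence with rank-2 image that
no algebraic codimension-2 class on `Y ⊗ C` induces; the entry point "instrument form ⟹ crux" is
`Theorems.coniveauOneFailure_of_nonalgebraic_curveCorrespondence_finrankTwo` (not restated here, so
that `ConiveauOneFailure_of` stays the unique composition concluding the crux).
[cite: GrothendieckTopology1969, p. 301] -/
theorem heart_iff_instrumentForm :
    (∃ (Y : SchemeOver ℂ) (_ : IsSmoothProjective 3 Y) (A : HodgeModel 3 Y)
      (s : Finset (complexBetti Y 3)),
      (∀ c ∈ s, IsRationalClass c) ∧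
      (Submodule.span ℂ (↑s : Set (complexBetti Y 3))).map (A.pullback 3).hom =
        (⨆ (p : ℕ) (q : ℕ) (_ : p + q = 3),
          (Submodule.span ℂ (↑s : Set (complexBetti Y 3))).map (A.pullback 3).hom ⊓
            A.hodgePQ 3 p q) ∧
      (Submodule.span ℂ (↑s : Set (complexBetti Y 3))).map (A.pullback 3).hom ≤
        (⨆ (p : ℕ) (q : ℕ) (_ : p + q = 3) (_ : 1 ≤ p) (_ : 1 ≤ q), A.hodgePQ 3 p q) ∧
      Module.finrank ℂ (A.hodgePQ 3 3 0) = 1 ∧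
      Module.finrank ℂ (Submodule.span ℂ (↑s : Set (complexBetti Y 3))) = 2 ∧
      ¬ CarriedByCurveCorrespondences Y (Submodule.span ℂ (↑s : Set (complexBetti Y 3)))) ↔
    ∃ (Y : SchemeOver ℂ) (hY : IsSmoothProjective 3 Y) (A : HodgeModel 3 Y) (C : SchemeOver ℂ)
      (hC : IsSmoothProjective 1 C) (B : HodgeModel 1 C) (φ : complexBetti C 1 →ₗ[ℂ] complexBetti Y 3),
      (∀ c, IsRationalClass c → IsRationalClass (φ c)) ∧
      (∀ (p q : ℕ), p + q = 1 → ∀ c, B.pullback 1 c ∈ B.hodgePQ 1 p q →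
        A.pullback 3 (φ c) ∈ A.hodgePQ 3 (p + 1) (q + 1)) ∧
      Module.finrank ℂ (A.hodgePQ 3 3 0) = 1 ∧
      Module.finrank ℂ (LinearMap.range φ) = 2 ∧
      ∀ μ : OrientationFamily, ¬ ∃ γ ∈ algebraicClasses (Y ⊗ C) 2,
        corrAction μ hY hC (show 1 + 2 * 2 = 3 + 2 * 1 from rfl) γ = φ :=
  Summit.HodgeConjecture.HodgeConjecture.Theorems.heart_iff_exists_nonalgebraic_curveCorrespondence

/-- **The habitat of the heart is inhabited** (LANDED, p153168,
`Theorems/SecondaryPeriodsConiveauOneFailureHabitat`): every clause of S3 except the last holds at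
`E_i³` — the heart is not vacuous-false by habitat. [cite: GrothendieckTopology1969, p. 300] -/
theorem habitat_inhabited :
    ∃ (Y : SchemeOver ℂ) (_ : IsSmoothProjective 3 Y) (A : HodgeModel 3 Y)
      (s : Finset (complexBetti Y 3)),
      (∀ c ∈ s, IsRationalClass c) ∧
      (Submodule.span ℂ (↑s : Set (complexBetti Y 3))).map (A.pullback 3).hom =
        (⨆ (p : ℕ) (q : ℕ) (_ : p + q = 3),
          (Submodule.span ℂ (↑s : Set (complexBetti Y 3))).map (A.pullback 3).hom ⊓
            A.hodgePQ 3 p q) ∧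
      (Submodule.span ℂ (↑s : Set (complexBetti Y 3))).map (A.pullback 3).hom ≤
        (⨆ (p : ℕ) (q : ℕ) (_ : p + q = 3) (_ : 1 ≤ p) (_ : 1 ≤ q), A.hodgePQ 3 p q) ∧
      Module.finrank ℂ (A.hodgePQ 3 3 0) = 1 ∧
      Module.finrank ℂ (Submodule.span ℂ (↑s : Set (complexBetti Y 3))) = 2 :=
  Summit.HodgeConjecture.HodgeConjecture.Theorems.exists_levelOnePlane_calabiYauType_ellipticCurveCubed

/-- **Tightness: the sub-Hodge binder of the crux is load-bearing** (LANDED, p153729,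
`Theorems/SecondaryPeriodsConiveauOneFailureTightness`): GHC(3,1) WITHOUT the sub-Hodge binder is
false (`E_τ³`, Grothendieck 1969), so a proof of the crux cannot come from dropping it.
[cite: GrothendieckTopology1969, pp. 299–300] -/
theorem variant_without_isSubHodge_false :
    ¬ ∀ ⦃Y : SchemeOver ℂ⦄, IsSmoothProjective 3 Y → ∀ (A : HodgeModel 3 Y)
        (s : Finset (complexBetti Y 3)), (∀ c ∈ s, IsRationalClass c) →
        (Submodule.span ℂ (↑s : Set (complexBetti Y 3))).map (A.pullback 3).hom ≤
          (⨆ (p : ℕ) (q : ℕ) (_ : p + q = 3) (_ : 1 ≤ p) (_ : 1 ≤ q), A.hodgePQ 3 p q) →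
        Submodule.span ℂ (↑s : Set (complexBetti Y 3)) ≤ supportedClasses Y 3 1 :=
  Summit.HodgeConjecture.HodgeConjecture.Theorems.levelOneConiveauThreefolds_false_without_isSubHodge

/-! ### Lead c3 (gen 2d): the abelian sector of the habitat is not a witness (granted Markman 2025) — LANDED, aliases -/

/-- **A rank-two plane satisfying the heart's Hodge-theoretic clauses is `φ(H¹(E(ℂ)))` for a
ONE-DIMENSIONAL ABELIAN VARIETY `E`** (LANDED, `Theorems/SecondaryPeriodsConiveauOneFailureLevelOneReductionInClass`,
p164505 over p163891): rank-two Riemann with the elliptic curve's group law remembered, so that "HC on the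
abelian fourfold `A × E`" can be invoked when `Y = A.X` is abelian.
[cite: VoisinHodgeI2002, §7.2.2 and §7.3.1 Lemma 7.26] [cite: SilvermanAEC2009, III.3.6 and VI Prop. 3.6 (b)] -/
theorem rankTwoPlane_eq_range_of_abelianCurve {Y : SchemeOver ℂ} (hY : IsSmoothProjective 3 Y)
    (A : HodgeModel 3 Y) (s : Finset (complexBetti Y 3)) (hs : ∀ c ∈ s, IsRationalClass c)
    (hs2 : Module.finrank ℂ (Submodule.span ℂ (↑s : Set (complexBetti Y 3))) = 2)
    (hsub : (Submodule.span ℂ (↑s : Set (complexBetti Y 3))).map (A.pullback 3).hom =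
      ⨆ (p : ℕ) (q : ℕ) (_ : p + q = 3),
        (Submodule.span ℂ (↑s : Set (complexBetti Y 3))).map (A.pullback 3).hom ⊓ A.hodgePQ 3 p q)
    (hlev : (Submodule.span ℂ (↑s : Set (complexBetti Y 3))).map (A.pullback 3).hom ≤
      ⨆ (p : ℕ) (q : ℕ) (_ : p + q = 3) (_ : 1 ≤ p) (_ : 1 ≤ q), A.hodgePQ 3 p q) :
    ∃ (E : AbelianVariety ℂ) (_ : E.dim = 1) (_ : IsSmoothProjective 1 E.X) (B : HodgeModel 1 E.X)
      (φ : complexBetti E.X 1 →ₗ[ℂ] complexBetti Y 3),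
      (∀ c, IsRationalClass c → IsRationalClass (φ c)) ∧
      (∀ (p q : ℕ), p + q = 1 → ∀ c, B.pullback 1 c ∈ B.hodgePQ 1 p q →
        A.pullback 3 (φ c) ∈ A.hodgePQ 3 (p + 1) (q + 1)) ∧
      LinearMap.range φ = Submodule.span ℂ (↑s : Set (complexBetti Y 3)) :=
  Summit.HodgeConjecture.HodgeConjecture.Theorems.exists_abelianCurve_of_levelOne_threefold_span_of_finrank_eq_two
    hY A s hs hs2 hsub hlev

/-- **A witness of the heart S3 is not isomorphic to an abelian threefold, granted Markman 2025**
(LANDED, `Theorems/SecondaryPeriodsConiveauOneFailureAbelianNoGo`, p165220): if `(Y, A, s)` satisfies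
every clause of the heart (the clause `h^{3,0} = 1` is not even needed) then `Y` is not isomorphic,
as a `ℂ`-scheme, to the underlying variety of a complex abelian variety of dimension `3` — HC for the
abelian fourfold `A × E` (Markman), transported along `Y ⊗ E ≅ A ⊗ E`, would carry the plane. So the
witness must be sought at NON-abelian Calabi–Yau-type threefolds.
[claim: Markman2025SurveySecant, status: under-review] [cite: GrothendieckTopology1969, p. 301] -/
theorem heartWitness_not_iso_abelianThreefold
    (hM : Markman2025_hodgeClasses_algebraic_abelian_dim_le_five)
    {Y : SchemeOver ℂ} (hY : IsSmoothProjective 3 Y) (A : HodgeModel 3 Y)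
    (s : Finset (complexBetti Y 3)) (hs : ∀ c ∈ s, IsRationalClass c)
    (hsub : (Submodule.span ℂ (↑s : Set (complexBetti Y 3))).map (A.pullback 3).hom =
      ⨆ (p : ℕ) (q : ℕ) (_ : p + q = 3),
        (Submodule.span ℂ (↑s : Set (complexBetti Y 3))).map (A.pullback 3).hom ⊓ A.hodgePQ 3 p q)
    (hlev : (Submodule.span ℂ (↑s : Set (complexBetti Y 3))).map (A.pullback 3).hom ≤
      ⨆ (p : ℕ) (q : ℕ) (_ : p + q = 3) (_ : 1 ≤ p) (_ : 1 ≤ q), A.hodgePQ 3 p q)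
    (hs2 : Module.finrank ℂ (Submodule.span ℂ (↑s : Set (complexBetti Y 3))) = 2)
    (hoff : ¬ CarriedByCurveCorrespondences Y (Submodule.span ℂ (↑s : Set (complexBetti Y 3)))) :
    ¬ ∃ B : AbelianVariety ℂ, B.dim = 3 ∧ Nonempty (Y ≅ B.X) :=
  Summit.HodgeConjecture.HodgeConjecture.Theorems.not_iso_abelianThreefold_of_heartWitness hM hY A s hs
    hsub hlev hs2 hoff

/-- **Calibration kill criterion (c) in rank two, granted Markman 2025** (LANDED,
`Theorems/SecondaryPeriodsConiveauOneFailureAbelianNoGo`, p165220): at Grothendieck's calibration threefold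
`E_τ³ = cubeScheme τ hτ` of the route every rank-two rational level-one sub-Hodge plane of `H³` lies in
`N¹H³`, hence (converse transfer) is carried by curve correspondences — the heart's obstruction FAILS
there for every rank-two plane (compare `habitat_inhabited`, where the other clauses hold at `E_i³`).
[claim: Markman2025SurveySecant, status: under-review] [cite: GrothendieckTopology1969, p. 300] -/
theorem calibration_rankTwo_carried
    (hM : Markman2025_hodgeClasses_algebraic_abelian_dim_le_five) (τ : ℂ) (hτ : τ.im ≠ 0)
    (A : HodgeModel 3 (Literature.Barriers.HodgeConjecture.cubeScheme τ hτ))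
    (s : Finset (complexBetti (Literature.Barriers.HodgeConjecture.cubeScheme τ hτ) 3))
    (hs : ∀ c ∈ s, IsRationalClass c)
    (hs2 : Module.finrank ℂ (Submodule.span ℂ
      (↑s : Set (complexBetti (Literature.Barriers.HodgeConjecture.cubeScheme τ hτ) 3))) = 2)
    (hsub : (Submodule.span ℂ (↑s : Set (complexBetti (Literature.Barriers.HodgeConjecture.cubeScheme τ hτ) 3))).map
        (A.pullback 3).hom =
      ⨆ (p : ℕ) (q : ℕ) (_ : p + q = 3),
        (Submodule.span ℂ (↑s : Set (complexBetti (Literature.Barriers.HodgeConjecture.cubeScheme τ hτ) 3))).map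
          (A.pullback 3).hom ⊓ A.hodgePQ 3 p q)
    (hlev : (Submodule.span ℂ (↑s : Set (complexBetti (Literature.Barriers.HodgeConjecture.cubeScheme τ hτ) 3))).map
        (A.pullback 3).hom ≤
      ⨆ (p : ℕ) (q : ℕ) (_ : p + q = 3) (_ : 1 ≤ p) (_ : 1 ≤ q), A.hodgePQ 3 p q) :
    CarriedByCurveCorrespondences (Literature.Barriers.HodgeConjecture.cubeScheme τ hτ)
      (Submodule.span ℂ (↑s : Set (complexBetti (Literature.Barriers.HodgeConjecture.cubeScheme τ hτ) 3))) :=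
  (Summit.HodgeConjecture.HodgeConjecture.Theorems.le_supportedClasses_iff_exists_curveCorrespondences
    (Literature.Barriers.HodgeConjecture.isSmoothProjective_cubeScheme τ hτ) _).1
    (Summit.HodgeConjecture.HodgeConjecture.Theorems.span_le_supportedClasses_of_finrank_eq_two_ellipticCurveCubed
      hM τ hτ A s hs hs2 hsub hlev)

end Summit.HodgeConjecture.HodgeConjecture.Cruxes.ConiveauOneFailure.Birth

end
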